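import Summits.Ventures.PackingBounds.Configurations.ListConfig


/-!
# The `D₄` root system (24-cell) as an explicit 24-point kissing configuration on `S³`

Framing: lottery ticket; floor = certified bounds/negative ranges. Venture `PackingBounds` (cell
`pub-packcert`, seat `pub-packcert-energy`) — the **attained side** for `(n, N) = (4, 24)`.

`vecs` lists the `24` minimal vectors `±e_i ± e_j` of `D₄` (squared length `2`; normalised, the
vertices of the 24-cell). The kernel checks the distance distribution `-1, -1/2, 0, 1/2` with
multiplicities `1, 8, 6, 8`; consequences: a kissing configuration of `24` unit vectors in `ℝ⁴`
exists (`κ(4) ≥ 24`; the cell's kernel-checked LP bound is `κ(4) ≤ 25`, `Kissing.kissing_dim4_le_25`,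
Musin's `24` needs more than LP), and for every potential `a` the 24-cell has `a`-energy
`24 (a(-1) + 8 a(-1/2) + 6 a(0) + 8 a(1/2))` — the certified UPPER end of the cell's `(4, 24)` energy
brackets (`Energy/BoundDimensionFourCard24`, …; `D₄` is conjecturally optimal for many but not all
completely monotone potentials: Cohn–Conway–Elkies–Kumar 2007).

## References
* J. H. Conway, N. J. A. Sloane, *Sphere Packings, Lattices and Groups*, Ch. 4 §7.2. [`ConwaySloane1999`]
-/

namespace Summit.Ventures.PackingBounds.Config.D4

open Finset Summit.Ventures.PackingBounds.Config

set_option maxHeartbeats 4000000 in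
/-- The `24` minimal vectors `±e_i ± e_j` (`i < j`) of `D₄`. [cite: ConwaySloane1999, Ch. 4 §7.2] -/
def vecs : List (List ℤ) := [
  [1, 1, 0, 0],
  [1, -1, 0, 0],
  [-1, 1, 0, 0],
  [-1, -1, 0, 0],
  [1, 0, 1, 0],
  [1, 0, -1, 0],
  [-1, 0, 1, 0],
  [-1, 0, -1, 0],
  [1, 0, 0, 1],
  [1, 0, 0, -1],
  [-1, 0, 0, 1],
  [-1, 0, 0, -1],
  [0, 1, 1, 0],
  [0, 1, -1, 0],
  [0, -1, 1, 0],
  [0, -1, -1, 0],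
  [0, 1, 0, 1],
  [0, 1, 0, -1],
  [0, -1, 0, 1],
  [0, -1, 0, -1],
  [0, 0, 1, 1],
  [0, 0, 1, -1],
  [0, 0, -1, 1],
  [0, 0, -1, -1]]

/-- The distance table: dot products of a member with the other members, with multiplicities. -/
def table : List (ℤ × ℕ) := [(-2, 1), (-1, 8), (0, 6), (1, 8)]

/-- Kernel check: `24` coordinate lists. -/
theorem length_vecs : vecs.length = 24 := by decide +kernel

set_option maxRecDepth 100000 in
/-- Kernel check: the coordinate lists are pairwise distinct. -/
private theorem nodup_vecs : vecs.Nodup := by decide +kernel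

set_option maxRecDepth 100000 in
/-- Kernel check: every list has length `4` and the prescribed squared length. -/
private theorem shape_vecs : shapeOK vecs 4 (2 : ℤ) = true := by decide +kernel

/-- Kernel check: the table keys are distinct and differ from the squared length. -/
private theorem keys_table : keysOK table (2 : ℤ) = true := by decide +kernel

set_option maxRecDepth 100000 in
/-- Kernel check (the distance distribution): the dot products of every member with the other members
have exactly the tabulated multiplicities and take no other value. -/
private theorem hist_vecs : histOK vecs table vecs = true := by decide +kernel


/-- The configuration: the normalised coordinate lists as points of `ℝ^4`. -/
noncomputable def pts : Finset (EuclideanSpace ℝ (Fin 4)) := config (Int.castRingHom ℝ) 4 (2 : ℤ) vecs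

/-- `ι q > 0`. -/
private theorem hq : 0 < (Int.castRingHom ℝ) (2 : ℤ) := by simp

/-- `pts` has `24` points. -/
theorem card_pts : pts.card = 24 := by
  rw [pts, card_eq Int.cast_injective hq shape_vecs keys_table hist_vecs nodup_vecs, length_vecs]

/-- Every point of `pts` is a unit vector. -/
private theorem norm_pts : ∀ x ∈ pts, ‖x‖ = 1 := norm_eq_one hq shape_vecs

/-- Distinct points of `pts` have inner product `ι d / ι q` for a key `d` of the table. -/
private theorem inner_pts : ∀ x ∈ pts, ∀ y ∈ pts, x ≠ y → ∃ p ∈ table, inner ℝ x y = (Int.castRingHom ℝ) p.1 / (Int.castRingHom ℝ) (2 : ℤ) :=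
  inner_mem hq shape_vecs hist_vecs

/-- **Energy of the configuration**: for every potential `a`, `Σ_{x ≠ y ∈ pts} a(⟪x,y⟫)` equals the
tabulated value. -/
theorem energy_pts (a : ℝ → ℝ) :
    ∑ x ∈ pts, ∑ y ∈ pts.erase x, a (inner ℝ x y) =
      (24 : ℝ) * (a (-1) + 8 * a (-1 / 2) + 6 * a 0 + 8 * a (1 / 2)) := by
  rw [pts, energy_eq Int.cast_injective hq shape_vecs keys_table hist_vecs nodup_vecs a, length_vecs]
  simp only [table, List.map_cons, List.map_nil, List.sum_cons, List.sum_nil, Nat.cast_ofNat, Nat.cast_one]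
  norm_num
  ring

/-- Distinct points of `pts` have inner product `≤ 1 / 2`. -/
private theorem inner_pts_le : ∀ x ∈ pts, ∀ y ∈ pts, x ≠ y → inner ℝ x y ≤ 1 / 2 := by
  refine inner_le hq shape_vecs hist_vecs (1 / 2) fun p hp => ?_
  simp only [table, List.mem_cons, List.not_mem_nil, or_false] at hp
  rcases hp with rfl | rfl | rfl | rfl <;> norm_num

/-- **`κ(4) ≥ 24`, attained side**: `24` unit vectors of `ℝ⁴` with pairwise inner products `≤ 1/2` (the 24-cell). [cite: ConwaySloane1999, Ch. 1 Table 1.2] -/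
theorem exists_kissing_24 : ∃ C : Finset (EuclideanSpace ℝ (Fin 4)),
    C.card = 24 ∧ (∀ x ∈ C, ‖x‖ = 1) ∧ (∀ x ∈ C, ∀ y ∈ C, x ≠ y → inner ℝ x y ≤ 1 / 2) :=
  ⟨pts, card_pts, norm_pts, inner_pts_le⟩

/-- **Energy value of the 24-cell**: for every potential `a` there is a `24`-point configuration on
`S³` with `a`-energy `24 (a(-1) + 8 a(-1/2) + 6 a(0) + 8 a(1/2))` (an upper bound for the
`(4, 24)` ground-state energy). -/
theorem exists_energy_24 (a : ℝ → ℝ) : ∃ C : Finset (EuclideanSpace ℝ (Fin 4)),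
    (∀ x ∈ C, ‖x‖ = 1) ∧ C.card = 24 ∧
      ∑ x ∈ C, ∑ y ∈ C.erase x, a (inner ℝ x y) =
        (24 : ℝ) * (a (-1) + 8 * a (-1 / 2) + 6 * a 0 + 8 * a (1 / 2)) :=
  ⟨pts, norm_pts, card_pts, energy_pts a⟩

end Summit.Ventures.PackingBounds.Config.D4
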